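import Summits.NavierStokesRegularity.NavierStokesRegularity.Theorems.AdaptedFrequencyAdaptedKernelExistsLowerOfUpperBridge

/-!
# Crux `AdaptedKernelExists` (stmt-NavierStokesRegularity-2956), line `nash-entropy-last-block`:
  the BRIDGE for STUB `stub_prekernelBounds` (smooth classical solution ↦ local drift–heat class)

Helper file (lands `--supports stmt-NavierStokesRegularity-2956`) for the registered stub
`stub_prekernelBounds` of the line's skeleton (positivity and the upper comparison for the smooth
representative `g` of `Γ + w`, `Γ` the backward heat kernel from the pole `(T, x₀)`, `w` an `L²`
corrector vanishing off the strip `Ioo ta Ta × E`). For a general finite-dimensional inner product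
space `E` this file proves:

* `prekernel_bridge`: for `g` jointly smooth on the open slab `Ioo ta T × E` and a classical
  solution of `∂ₜg + b·∇g + νΔg = 0` there (`‖b‖ ≤ B` on `Ico ta T`), the reversed and rescaled
  function `v(σ, x) = g(t₁ − σ/ν, x)`, `t₁ ∈ (ta, T)`, belongs to the tree's local time-integrated
  class `IsDriftHeatSolutionOn a v (B/ν) (Ico 0 (ν(t₁ − ta))) univ` of `v_σ + a·∇v − Δv = 0`
  (`DriftHeatLocalClass`), drift `a = −b/ν` (the computation of `lowerOfUpper_bridge` with the
  two-sided classical time derivative of `g`);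
* `prekernel_eq_above`: if `Γ + w = g` a.e. on the slab and `w = 0` off `Ioo ta Ta × E`, then
  `g(t, ·) = Γ(t, ·)` for every `t ∈ Ico Ta T` (a.e.-equal continuous functions agree on the open
  set `Ioo Ta T × E`, Mathlib `Measure.eqOn_open_of_ae_eq`; continuity of both time lines at `Ta`).

Its `ℝ³` form `stub_prekernelBounds_eqAbove` (claim (i) of the stub) is a registered sub-goal of
the crux item.
-/

noncomputable section

open MeasureTheory Set Filter Topology Metric Function Real
open scoped Laplacian ContDiff
open Literature.Analysis.FluidPDE

namespace Summit.NavierStokesRegularity.NavierStokesRegularity.Theorems.AdaptedKernelExists.NashEntropyLastBlock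

section General

variable {E : Type*} [NormedAddCommGroup E] [InnerProductSpace ℝ E] [FiniteDimensional ℝ E]

/-- Bookkeeping of the reversed time `s = t₁ − σ/ν`: for `σ ∈ [0, ν(t₁ − ta))` it lies in
`(ta, t₁]` and the clamp `max ta (min t₁ ·)` does nothing. -/
theorem prekernel_clamp {ν ta t₁ σ : ℝ} (hν : 0 < ν) (hσ : σ ∈ Ico 0 (ν * (t₁ - ta))) :
    max ta (min t₁ (t₁ - σ / ν)) = t₁ - σ / ν ∧ t₁ - σ / ν ∈ Ioc ta t₁ := by
  have h1 : 0 ≤ σ / ν := div_nonneg hσ.1 hν.le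
  have h2 : σ / ν < t₁ - ta := by rw [div_lt_iff₀ hν]; linarith [hσ.2]
  refine ⟨?_, by linarith, by linarith⟩
  rw [min_eq_right (by linarith), max_eq_right (by linarith)]

/-- On a block `[t, t₁]`: for `σ ∈ [0, ν(t₁ − t)]` the reversed time `t₁ − σ/ν` lies in
`[t, t₁]`. -/
theorem prekernel_mem_Icc {ν t t₁ σ : ℝ} (hν : 0 < ν) (hσ : σ ∈ Icc 0 (ν * (t₁ - t))) :
    t₁ - σ / ν ∈ Icc t t₁ := by
  have h1 : 0 ≤ σ / ν := div_nonneg hσ.1 hν.le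
  have h2 : σ / ν ≤ t₁ - t := by rw [div_le_iff₀ hν]; linarith [hσ.2]
  exact ⟨by linarith, by linarith⟩

omit [FiniteDimensional ℝ E] in
/-- The time slices `g s`, `s ∈ Ioo ta T`, of a function jointly smooth on the open slab are
`C²`. -/
theorem prekernel_contDiff_slice {ta T : ℝ} {g : ℝ → E → ℝ}
    (hg : IsSmoothSpaceTimeOn (Ioo ta T) g) {s : ℝ} (hs : s ∈ Ioo ta T) :
    ContDiff ℝ 2 (g s) := by
  have hg2 : ContDiffOn ℝ 2 (uncurry g) (Ioo ta T ×ˢ univ) := hg.of_le (by norm_cast)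
  have hc : ContDiff ℝ 2 (fun x : E => ((s, x) : ℝ × E)) := contDiff_const.prodMk contDiff_id
  have := hg2.comp_contDiff hc (fun x => mk_mem_prod hs (mem_univ x))
  simpa [Function.comp_def] using this

variable [MeasurableSpace E] [BorelSpace E]

/-- **The bridge.** Let `g` be jointly smooth on the open slab `Ioo ta T × E` and a classical
solution of `∂ₜg + b·∇g + νΔg = 0` there, the drift `b` being jointly smooth on `Ico ta T × E`
with `‖b‖ ≤ B`. For `t₁ ∈ (ta, T)` the reversed and rescaled function `v(σ, x) = g(t₁ − σ/ν, x)`,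
`σ ∈ [0, ν(t₁ − ta))`, belongs to the tree's local time-integrated class of `v_σ + a·∇v − Δv = 0`
with a measurable drift `a` (`= −b(t₁ − σ/ν)/ν` there) bounded by `B/ν`: slices are `C²`,
`D(v σ)`, `Δ(v σ)` are jointly continuous, and `v(σ₂) − v(σ₁) = ∫ (Δv − Dv[a])` by the equation
and the fundamental theorem of calculus. -/
theorem prekernel_bridge {ν ta T t₁ B : ℝ} {b : ℝ → E → E} {g : ℝ → E → ℝ}
    (hν : 0 < ν) (hta : ta < t₁) (ht₁ : t₁ < T)
    (hb : IsSmoothSpaceTimeOn (Ico ta T) b) (hB : ∀ s ∈ Ico ta T, ∀ x, ‖b s x‖ ≤ B)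
    (hg : IsSmoothSpaceTimeOn (Ioo ta T) g)
    (heq : ∀ s ∈ Ioo ta T, ∀ x,
      deriv (fun r => g r x) s + fderiv ℝ (g s) x (b s x) + ν * (Δ (g s)) x = 0) :
    ∃ a : ℝ → E → E,
      IsDriftHeatSolutionOn a (fun σ => g (t₁ - σ / ν)) (B / ν) (Ico 0 (ν * (t₁ - ta))) univ := by
  have hIoo : Ioc ta t₁ ⊆ Ioo ta T := fun s hs => ⟨hs.1, hs.2.trans_lt ht₁⟩
  have hIco : Icc ta t₁ ⊆ Ico ta T := fun s hs => ⟨hs.1, hs.2.trans_lt ht₁⟩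
  have hO : IsOpen (Ioo ta T ×ˢ (univ : Set E)) := isOpen_Ioo.prod isOpen_univ
  have hg2 : ContDiffOn ℝ 2 (uncurry g) (Ioo ta T ×ˢ univ) := hg.of_le (by norm_cast)
  obtain ⟨cl, hcl⟩ : ∃ cl : ℝ → ℝ, cl = fun σ => max ta (min t₁ (t₁ - σ / ν)) := ⟨_, rfl⟩
  have hclc : Continuous cl := by
    rw [hcl]
    exact continuous_const.max (continuous_const.min
      (continuous_const.sub (continuous_id.div_const ν)))
  have hclmem : ∀ σ, cl σ ∈ Icc ta t₁ := fun σ => by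
    rw [hcl]
    exact ⟨le_max_left _ _, max_le hta.le (min_le_left _ _)⟩
  have hclS : ∀ σ ∈ Ico 0 (ν * (t₁ - ta)), cl σ = t₁ - σ / ν := fun σ hσ => by
    rw [hcl]; exact (prekernel_clamp hν hσ).1
  have hsS : ∀ σ ∈ Ico 0 (ν * (t₁ - ta)), t₁ - σ / ν ∈ Ioc ta t₁ := fun σ hσ =>
    (prekernel_clamp hν hσ).2
  -- the drift
  have hac : Continuous fun p : ℝ × E => -(1 / ν) • b (cl p.1) p.2 := by
    have h1 : Continuous fun p : ℝ × E => (cl p.1, p.2) := by fun_prop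
    have h2 := hb.continuousOn.comp_continuous h1
      (fun p => ⟨hIco (hclmem p.1), mem_univ _⟩)
    exact continuous_const.smul h2
  have hJ1 := lowerOfUpper_continuousOn_fderiv_slice isOpen_Ioo hg2
  have hJ2 := lowerOfUpper_continuousOn_laplacian_slice isOpen_Ioo hg2
  have hmap : Continuous fun p : ℝ × E => (t₁ - p.1 / ν, p.2) := by fun_prop
  have hmaps : MapsTo (fun p : ℝ × E => (t₁ - p.1 / ν, p.2)) (Ico 0 (ν * (t₁ - ta)) ×ˢ univ)
      (Ioo ta T ×ˢ univ) := fun p hp => ⟨hIoo (hsS p.1 hp.1), mem_univ _⟩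
  have hD : ContinuousOn (fun p : ℝ × E => fderiv ℝ (g (t₁ - p.1 / ν)) p.2)
      (Ico 0 (ν * (t₁ - ta)) ×ˢ univ) := by
    have h := hJ1.comp hmap.continuousOn hmaps
    exact h
  have hL : ContinuousOn (fun p : ℝ × E => (Δ (g (t₁ - p.1 / ν))) p.2)
      (Ico 0 (ν * (t₁ - ta)) ×ˢ univ) := by
    have h := hJ2.comp hmap.continuousOn hmaps
    exact h
  refine ⟨fun σ x => -(1 / ν) • b (cl σ) x, hac.measurable, ?_, ?_, hD, hL, ?_⟩
  · intro σ _ x _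
    rw [norm_smul, norm_neg, norm_div, norm_one, Real.norm_of_nonneg hν.le]
    calc 1 / ν * ‖b (cl σ) x‖ ≤ 1 / ν * B :=
          mul_le_mul_of_nonneg_left (hB _ (hIco (hclmem σ)) x) (by positivity)
      _ = B / ν := by ring
  · intro σ hσ
    exact (prekernel_contDiff_slice hg (hIoo (hsS σ hσ))).contDiffOn
  · intro x _ σ₁ hσ₁ σ₂ hσ₂ h12
    have hsub : uIcc σ₁ σ₂ ⊆ Ico 0 (ν * (t₁ - ta)) := by
      rw [uIcc_of_le h12]
      exact fun r hr => ⟨hσ₁.1.trans hr.1, hr.2.trans_lt hσ₂.2⟩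
    have hderiv : ∀ r ∈ uIcc σ₁ σ₂, HasDerivAt (fun r' => g (t₁ - r' / ν) x)
        ((Δ (g (t₁ - r / ν))) x -
          fderiv ℝ (g (t₁ - r / ν)) x (-(1 / ν) • b (cl r) x)) r := by
      intro r hr
      have hrS := hsub hr
      have hs := hIoo (hsS r hrS)
      have hd : HasFDerivAt (uncurry g) (fderiv ℝ (uncurry g) (t₁ - r / ν, x))
          (t₁ - r / ν, x) :=
        ((hg2.differentiableOn (by norm_num)).differentiableAt
          (hO.mem_nhds ⟨hs, mem_univ x⟩)).hasFDerivAt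
      have htl := hasDerivAt_timeLine hd
      have he := heq (t₁ - r / ν) hs x
      rw [htl.deriv] at he
      have hlin : HasDerivAt (fun r' : ℝ => t₁ - r' / ν) (-(1 / ν)) r := by
        simpa using ((hasDerivAt_id r).div_const ν).const_sub t₁
      refine (htl.comp r hlin).congr_deriv ?_
      rw [hclS r hrS, map_smul, smul_eq_mul,
        show fderiv ℝ (uncurry g) (t₁ - r / ν, x) (1, 0) =
          -(fderiv ℝ (g (t₁ - r / ν)) x (b (t₁ - r / ν) x)) -
            ν * (Δ (g (t₁ - r / ν))) x by linarith]
      field_simp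
      ring
    have hcont : ContinuousOn (fun r => (Δ (g (t₁ - r / ν))) x -
        fderiv ℝ (g (t₁ - r / ν)) x (-(1 / ν) • b (cl r) x)) (uIcc σ₁ σ₂) := by
      have h1 := continuousOn_time_slice
        (F := fun p : ℝ × E => (Δ (g (t₁ - p.1 / ν))) p.2) hL (mem_univ x) hsub
      have h2 := continuousOn_time_slice
        (F := fun p : ℝ × E => fderiv ℝ (g (t₁ - p.1 / ν)) p.2) hD (mem_univ x) hsub
      have h3 : Continuous fun r : ℝ => -(1 / ν) • b (cl r) x :=
        hac.comp (continuous_id.prodMk continuous_const)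
      exact h1.sub (h2.clm_apply h3.continuousOn)
    exact (intervalIntegral.integral_eq_sub_of_hasDerivAt hderiv hcont.intervalIntegrable).symm

/-- **Claim (i): `g = Γ` above the strip.** If `Γ + w = g` a.e. on the open slab
`Ioo ta T × E` (`Γ = backwardHeatKernel ν T x₀`), `w = 0` off `Ioo ta Ta × E` and `g` is jointly
smooth on the slab, then `g(t, ·) = Γ(t, ·)` for every `t ∈ Ico Ta T`: on the open set
`Ioo Ta T × E` the two sides are continuous and a.e. equal, hence equal
(`Measure.eqOn_open_of_ae_eq`, Lebesgue measure charges open sets), and at `t = Ta ∈ (ta, T)`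
both time lines are continuous. -/
theorem prekernel_eq_above {ν ta Ta T : ℝ} {x₀ : E} {w : ℝ × E → ℝ} {g : ℝ → E → ℝ}
    (hν : 0 < ν) (hta : ta < Ta) (hTa : Ta < T)
    (hw0 : ∀ p : ℝ × E, p.1 ∉ Ioo ta Ta → w p = 0)
    (hg : IsSmoothSpaceTimeOn (Ioo ta T) g)
    (hae : ∀ᵐ p : ℝ × E, p ∈ Ioo ta T ×ˢ univ →
      backwardHeatKernel ν T x₀ p.1 p.2 + w p = g p.1 p.2) :
    ∀ t ∈ Ico Ta T, g t = backwardHeatKernel ν T x₀ t := by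
  have hU : IsOpen (Ioo Ta T ×ˢ (univ : Set E)) := isOpen_Ioo.prod isOpen_univ
  have hsub : Ioo Ta T ×ˢ (univ : Set E) ⊆ Ioo ta T ×ˢ univ :=
    prod_mono (Ioo_subset_Ioo_left hta.le) Subset.rfl
  have hgc : ContinuousOn (uncurry g) (Ioo Ta T ×ˢ univ) := hg.continuousOn.mono hsub
  have hΓc0 : ContinuousOn (uncurry (backwardHeatKernel ν T x₀)) (Iio T ×ˢ univ) :=
    (contDiffOn_uncurry_backwardHeatKernel hν T x₀ (m := 0)).continuousOn
  have hΓc : ContinuousOn (uncurry (backwardHeatKernel ν T x₀)) (Ioo Ta T ×ˢ univ) :=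
    hΓc0.mono (prod_mono Ioo_subset_Iio_self Subset.rfl)
  have hae' : uncurry g =ᵐ[volume.restrict (Ioo Ta T ×ˢ univ)]
      uncurry (backwardHeatKernel ν T x₀) := by
    rw [EventuallyEq, ae_restrict_iff' hU.measurableSet]
    filter_upwards [hae] with p hp hpU
    have h1 := hp (hsub hpU)
    have h2 : w p = 0 := hw0 p fun h => lt_irrefl _ (h.2.trans hpU.1.1)
    show g p.1 p.2 = backwardHeatKernel ν T x₀ p.1 p.2
    rw [← h1, h2, add_zero]
  have hEq : EqOn (uncurry g) (uncurry (backwardHeatKernel ν T x₀)) (Ioo Ta T ×ˢ univ) :=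
    Measure.eqOn_open_of_ae_eq hae' hU hgc hΓc
  have hopen : ∀ t ∈ Ioo Ta T, ∀ x, g t x = backwardHeatKernel ν T x₀ t x := fun t ht x =>
    hEq (mk_mem_prod ht (mem_univ x))
  intro t ht
  funext x
  rcases eq_or_lt_of_le ht.1 with h | h
  · subst h
    have hc1 : Continuous fun s : ℝ => ((s, x) : ℝ × E) := by fun_prop
    have hga : ContinuousAt (fun s => g s x) Ta := by
      have h1 : ContinuousAt (uncurry g) (Ta, x) :=
        hg.continuousOn.continuousAt
          ((isOpen_Ioo.prod isOpen_univ).mem_nhds ⟨⟨hta, hTa⟩, mem_univ x⟩)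
      exact ContinuousAt.comp (f := fun s : ℝ => ((s, x) : ℝ × E)) h1 hc1.continuousAt
    have hΓa : ContinuousAt (fun s => backwardHeatKernel ν T x₀ s x) Ta := by
      have h1 : ContinuousAt (uncurry (backwardHeatKernel ν T x₀)) (Ta, x) :=
        hΓc0.continuousAt ((isOpen_Iio.prod isOpen_univ).mem_nhds ⟨hTa, mem_univ x⟩)
      exact ContinuousAt.comp (f := fun s : ℝ => ((s, x) : ℝ × E)) h1 hc1.continuousAt
    have hev : (fun s => g s x) =ᶠ[𝓝[>] Ta] fun s => backwardHeatKernel ν T x₀ s x := by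
      filter_upwards [Ioo_mem_nhdsGT hTa] with s hs using hopen s hs x
    exact tendsto_nhds_unique_of_eventuallyEq (hga.tendsto.mono_left nhdsWithin_le_nhds)
      (hΓa.tendsto.mono_left nhdsWithin_le_nhds) hev
  · exact hopen t ⟨h, ht.2⟩ x

end General

/-! ### The registered sub-goal (dimension three) -/

/-- **Registered sub-goal `stub_prekernelBounds_eqAbove`** (the `ℝ³` form of
`prekernel_eq_above`, claim (i) of STUB `stub_prekernelBounds`): if `Γ + w = g` a.e. on the
open slab `Ioo ta T × ℝ³`, `w = 0` off the strip `Ioo ta Ta × ℝ³` and `g` is jointly smooth on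
the slab, then `g(t, ·) = Γ(t, ·)` for every `t ∈ Ico Ta T`. -/
theorem stub_prekernelBounds_eqAbove :
    ∀ (ν ta Ta T : ℝ) (x₀ : EuclideanSpace ℝ (Fin 3)) (w : ℝ × EuclideanSpace ℝ (Fin 3) → ℝ) (g : ℝ → EuclideanSpace ℝ (Fin 3) → ℝ), 0 < ν → ta < Ta → Ta < T → (∀ p, p.1 ∉ Ioo ta Ta → w p = 0) → IsSmoothSpaceTimeOn (Ioo ta T) g → (∀ᵐ p : ℝ × EuclideanSpace ℝ (Fin 3), p ∈ Ioo ta T ×ˢ univ → backwardHeatKernel ν T x₀ p.1 p.2 + w p = g p.1 p.2) → ∀ t ∈ Ico Ta T, g t = backwardHeatKernel ν T x₀ t :=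
  fun _ _ _ _ _ _ _ hν hta hTa hw0 hg hae => prekernel_eq_above hν hta hTa hw0 hg hae

end Summit.NavierStokesRegularity.NavierStokesRegularity.Theorems.AdaptedKernelExists.NashEntropyLastBlock

end
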